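import Summits.HodgeConjecture.HodgeCM.Prior.AllgGroup_1

/-! PORT of `HodgeCM/Prior/AllgGroup.lean` (HodgeCMPerL run 82) — part 2: continuation of `Summits.HodgeConjecture.HodgeCM.Prior.AllgGroup_1` (split at a top-level declaration boundary by port_pkg.py; scope re-opened below; declarations unchanged). -/

-- port_pkg: scope re-opened for this part (file-level context, then the namespace/section stack open at the cut)
namespace HodgeCM.Prior.AllgGroup
namespace RfwfAllgGroup
noncomputable section
open Finsupp
open scoped symmDiff
variable {G : Type*} [Group G] [Fintype G] [DecidableEq G]
variable (c : G)
/-- The induction of COR-CM (a), run on the deviation set from the base type `T₀`: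
`[Φ] − θ(1_Φ)` lies in the span of the faces. -/
lemma single_sub_thetaG_mem (hc2 : c * c = 1) (T₀ : CMF G c) :
    ∀ (n : ℕ) (Φ : CMF G c), (T₀.1 \ Φ.1).card = n →
      single Φ 1 - thetaG c hc2 T₀ (typeSum G c (single Φ 1))
        ∈ Submodule.span ℤ (gfaceSet G c hc2) := by
  intro n
  induction n using Nat.strong_induction_on with
  | h n ih =>
  intro Φ hn
  rcases n with _ | (_ | m)
  · -- deviation ∅: Φ = T₀, and θ(1_{T₀}) = [T₀]
    have hΦ : Φ = T₀ := eq_of_dev_empty c (Finset.card_eq_zero.mp hn)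
    rw [hΦ]
    have hθ : thetaG c hc2 T₀ (typeSum G c (single T₀ 1)) = single T₀ 1 := by
      rw [typeSum_single, thetaG_apply]
      rw [Finset.sum_eq_zero, indG_pair c T₀ 1, one_smul, zero_add]
      intro t ht
      have h0 : indG T₀.1 (c * t) = 0 := by
        unfold indG
        rw [if_neg ((T₀.2 t).mp ht)]
      rw [h0, zero_smul]
    rw [hθ, sub_self]
    exact Submodule.zero_mem _
  · -- deviation {s}: Φ = T₀^{(s)}, and θ(1_Φ) = [Φ]
    obtain ⟨s, hs⟩ := Finset.card_eq_one.mp hn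
    have hmem : s ∈ T₀.1 \ Φ.1 := hs ▸ Finset.mem_singleton_self s
    have hsT : s ∈ T₀.1 := (Finset.mem_sdiff.mp hmem).1
    have hd : Φ = oflipCM c hc2 s T₀ := eq_oflip_of_dev_singleton c hc2 hs
    rw [hd]
    have hθ : thetaG c hc2 T₀ (typeSum G c (single (oflipCM c hc2 s T₀) 1))
        = single (oflipCM c hc2 s T₀) 1 := by
      rw [typeSum_single, thetaG_apply]
      have hcoe1 : indG (oflipCM c hc2 s T₀).1 (c * s) = 1 := by
        show indG (oflip c s T₀.1) (c * s) = 1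
        rw [indG_oflip_of_mem c (by rw [mem_orb]; right; rfl)]
        have h0 : indG T₀.1 (c * s) = 0 := by
          unfold indG
          rw [if_neg ((T₀.2 s).mp hsT)]
        rw [h0, sub_zero]
      have hsum : (∑ t ∈ T₀.1, indG (oflipCM c hc2 s T₀).1 (c * t)
            • (single (oflipCM c hc2 t T₀) 1 - single T₀ 1) : CMF G c →₀ ℤ)
          = single (oflipCM c hc2 s T₀) 1 - single T₀ 1 := by
        rw [Finset.sum_eq_single s]
        · rw [hcoe1, one_smul]
        · intro b hb hbs
          have h0 : indG (oflipCM c hc2 s T₀).1 (c * b) = 0 := by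
            show indG (oflip c s T₀.1) (c * b) = 0
            have hbO : c * b ∉ orb c s := by
              rw [mem_orb]
              rintro (h1 | h1)
              · have hbcs : b = c * s := by rw [← h1, cmul_cmul c hc2]
                exact ((T₀.2 s).mp hsT) (hbcs ▸ hb)
              · exact hbs (mul_left_cancel h1)
            rw [indG_oflip_of_not_mem c hbO]
            unfold indG
            rw [if_neg ((T₀.2 b).mp hb)]
          rw [h0, zero_smul]
        · intro hs'
          exact absurd hsT hs'
      rw [hsum, indG_pair c (oflipCM c hc2 s T₀) 1, one_smul]
      abel
    rw [hθ, sub_self]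
    exact Submodule.zero_mem _
  · -- deviation of size m+2: pick two deviation places, use the face there, induct
    have h2 : 1 < (T₀.1 \ Φ.1).card := by omega
    obtain ⟨s, hsD, s', hs'D, hss'⟩ := Finset.one_lt_card.mp h2
    have hsT : s ∈ T₀.1 := (Finset.mem_sdiff.mp hsD).1
    have hsΦ : s ∉ Φ.1 := (Finset.mem_sdiff.mp hsD).2
    have hs'T : s' ∈ T₀.1 := (Finset.mem_sdiff.mp hs'D).1
    have hs'Φ : s' ∉ Φ.1 := (Finset.mem_sdiff.mp hs'D).2
    have hs'O : s' ∉ orb c s := by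
      rw [mem_orb]
      rintro (h1 | h1)
      · exact hss' h1.symm
      · exact ((T₀.2 s).mp hsT) (h1 ▸ hs'T)
    have hdev1 : (T₀.1 \ (oflipCM c hc2 s Φ).1).card = m + 1 := by
      rw [dev_oflip c hc2 hsT hsΦ, Finset.card_erase_of_mem hsD]
      omega
    have hdev2 : (T₀.1 \ (oflipCM c hc2 s' Φ).1).card = m + 1 := by
      rw [dev_oflip c hc2 hs'T hs'Φ, Finset.card_erase_of_mem hs'D]
      omega
    have hsflip : s ∉ (oflipCM c hc2 s' Φ).1 := by
      show s ∉ oflip c s' Φ.1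
      have hsO' : s ∉ orb c s' := by
        rw [mem_orb]
        rintro (h1 | h1)
        · exact hss' h1
        · exact ((T₀.2 s').mp hs'T) (h1 ▸ hsT)
      intro hmem
      rw [oflip, Finset.mem_symmDiff] at hmem
      rcases hmem with ⟨h1, -⟩ | ⟨h1, -⟩
      · exact hsΦ h1
      · exact hsO' h1
    have hdev3 : (T₀.1 \ (oflipCM c hc2 s (oflipCM c hc2 s' Φ)).1).card = m := by
      rw [dev_oflip c hc2 hsT hsflip, dev_oflip c hc2 hs'T hs'Φ,
        Finset.card_erase_of_mem (Finset.mem_erase.mpr ⟨hss', hsD⟩),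
        Finset.card_erase_of_mem hs'D]
      omega
    have hfacemem : gface c hc2 Φ s s' ∈ Submodule.span ℤ (gfaceSet G c hc2) :=
      Submodule.subset_span ⟨Φ, s, s', hs'O, rfl⟩
    have key : single Φ 1 - thetaG c hc2 T₀ (typeSum G c (single Φ 1))
        = (gface c hc2 Φ s s'
            - thetaG c hc2 T₀ (typeSum G c (gface c hc2 Φ s s')))
          + (single (oflipCM c hc2 s Φ) 1
              - thetaG c hc2 T₀ (typeSum G c (single (oflipCM c hc2 s Φ) 1)))
          + (single (oflipCM c hc2 s' Φ) 1
              - thetaG c hc2 T₀ (typeSum G c (single (oflipCM c hc2 s' Φ) 1)))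
          - (single (oflipCM c hc2 s (oflipCM c hc2 s' Φ)) 1
              - thetaG c hc2 T₀
                  (typeSum G c (single (oflipCM c hc2 s (oflipCM c hc2 s' Φ)) 1))) := by
      simp only [gface, map_add, map_sub]
      abel
    rw [key]
    refine Submodule.sub_mem _
      (Submodule.add_mem _ (Submodule.add_mem _ ?_ ?_) ?_) ?_
    · rw [typeSum_gface c hc2 Φ hs'O, map_zero, sub_zero]
      exact hfacemem
    · exact ih (m + 1) (by omega) _ hdev1
    · exact ih (m + 1) (by omega) _ hdev2
    · exact ih m (by omega) _ hdev3

/-- MAIN THEOREM (T1, group form): for every finite group `G` and involution `c ≠ 1`,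
the face relations generate `R_F := ker(Z[types] → Z[G])` over ℤ (integral generation,
index 1) — Lemma l:allg in the form the corollary chain consumes (COR-CM (a), paper
l.276-282), for ALL `g` at once. -/
theorem gfaces_generate (hc2 : c * c = 1) (hc1 : c ≠ 1) :
    Submodule.span ℤ (gfaceSet G c hc2) = LinearMap.ker (typeSum G c) := by
  obtain ⟨T₀f, hT₀⟩ := exists_isCMF c hc2 hc1
  apply le_antisymm
  · rw [Submodule.span_le]
    rintro y ⟨Φ, t, t', ht', rfl⟩
    exact LinearMap.mem_ker.mpr (typeSum_gface c hc2 Φ ht')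
  · intro x hx
    have hx0 : typeSum G c x = 0 := LinearMap.mem_ker.mp hx
    have htop : Submodule.span ℤ (Set.range fun Φ : CMF G c => single Φ 1)
        = (⊤ : Submodule ℤ (CMF G c →₀ ℤ)) := by
      have hb := (Finsupp.basisSingleOne (ι := CMF G c) (R := ℤ)).span_eq
      rwa [Finsupp.coe_basisSingleOne] at hb
    have hcomap : (⊤ : Submodule ℤ (CMF G c →₀ ℤ)) ≤
        Submodule.comap (LinearMap.id - (thetaG c hc2 ⟨T₀f, hT₀⟩).comp (typeSum G c))
          (Submodule.span ℤ (gfaceSet G c hc2)) := by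
      rw [← htop, Submodule.span_le]
      rintro y ⟨Φ, rfl⟩
      rw [SetLike.mem_coe, Submodule.mem_comap, LinearMap.sub_apply, LinearMap.id_apply,
        LinearMap.comp_apply]
      exact single_sub_thetaG_mem c hc2 ⟨T₀f, hT₀⟩ ((⟨T₀f, hT₀⟩ : CMF G c).1 \ Φ.1).card
        Φ rfl
    have hmem := hcomap (Submodule.mem_top (x := x))
    rw [Submodule.mem_comap, LinearMap.sub_apply, LinearMap.id_apply,
      LinearMap.comp_apply, hx0, map_zero, sub_zero] at hmem
    exact hmem

end

end RfwfAllgGroup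



end HodgeCM.Prior.AllgGroup
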